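import Summits.NavierStokesRegularity.NavierStokesRegularity.Theorems.NoOverheating.Negative.ExcludedStrataCensusV18
import Summits.NavierStokesRegularity.NavierStokesRegularity.Theorems.NoOverheating.Negative.RadialUnidirectionalLimitsExcluded

/-!
# KJ-73b — CENSUS v19 of the excluded strata of route `AngularGalerkinLadder`'s window sequences
# ((S0)–(S32′) of `excludedStrata_windowSequences_v18` + the DIVERGENCE-FREE LIMIT KINEMATICS strata
# of `RadialUnidirectionalLimitsExcluded` (KJ-73): (S33) asymptotically RADIAL, (S34) asymptotically
# UNIDIRECTIONAL velocity)

Refuter lineage (ns-blowup-refuter g19), Negative lane of crux K2 `NoOverheating`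
(stmt-NavierStokesRegularity-19960; supports, does not decide).  Pure assembly — this file proves
NOTHING new: it folds the kernel file `RadialUnidirectionalLimitsExcluded` into the census statement
of record, `excludedStrata_windowSequences_v19`, "what an admissible window sequence of K2 can NOT
be":

* (S33) for every `t < 0` and every `x`, `‖x‖² uₙ(t, x) − ⟪uₙ(t, x), x⟫ x → 0` — the non-radial
  part of the velocity dies pointwise (`…no_windowSequence_asymptoticallyRadial`: the Type-I ladder
  limit `v` (KJ-33a) then has RADIAL divergence-free `C^∞` slices, and a `C¹` divergence-free radial
  field on `ℝ³` is zero — Euler identity `D⟪v,x⟫[x] = −⟪v,x⟫` along rays — against the inherited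
  floor `δ ≤ ‖v(−1, x₀)‖`; only the slice `t = −1` is used);
* (S34) for some fixed `e ≠ 0`, every `t < 0` and every `x`, `‖e‖² uₙ(t, x) − ⟪uₙ(t, x), e⟫ e → 0`
  — the velocity becomes PARALLEL TO ONE LINE (`…no_windowSequence_asymptoticallyUnidirectional`:
  the limit slice is `a(x) e` with `∂ₑ a = div v = 0`, hence invariant under the translation by
  `e`, and Type-I spatial decay `C₀/(‖x‖ + 1)` kills a translation-invariant slice).

Census sentence after v19: as v18, AND (limit kinematics) the pointwise limit of an admissible
supply is neither radial nor a parallel (unidirectional) flow at `t = −1`.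
[cite: KochNadirashviliSereginSverak2009, Lemma 6.1 (limits of rescaled solutions), (1.6) (Type-I decay)] -/

namespace Summit.NavierStokesRegularity.AngularGalerkinLadderExcludedStrataCensusV19

open Set Filter MeasureTheory Topology Function
open scoped ENNReal RealInnerProductSpace ContDiff
open Literature.Analysis Literature.Analysis.FluidPDE
open Summit.NavierStokesRegularity.FluidComputer
open Summit.NavierStokesRegularity.NavierStokesRegularity.Theses.AngularGalerkinLadder
open Summit.NavierStokesRegularity.AngularGalerkinLadderExcludedStrataCensusV18
open Summit.NavierStokesRegularity.AngularGalerkinLadderRadialUnidirectionalLimitsExcluded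

/-- **Census theorem v19: the excluded strata (S0)–(S34) of K2's window sequences.**  As
`excludedStrata_windowSequences_v18`, plus the divergence-free limit kinematics strata: (S33)
`‖x‖² uₙ(t,x) − ⟪uₙ(t,x), x⟫ x → 0` (asymptotically radial) and (S34) `∃ e ≠ 0`,
`‖e‖² uₙ(t,x) − ⟪uₙ(t,x), e⟫ e → 0` (asymptotically unidirectional) — for ANY `C₀`, ANY window and
ANY rotations.
[cite: KochNadirashviliSereginSverak2009, Lemma 6.1 (limits of rescaled solutions), (1.6) (Type-I decay)] -/
theorem excludedStrata_windowSequences_v19 :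
    ∃ ε₀ : ℝ, 0 < ε₀ ∧ ∀ C₀ : ℝ, ∃ κ α₁ c₁ α₂ c₂ lam₁ β₁ β₂ lam₂ : ℝ,
      1 < κ ∧ 0 < α₁ ∧ 1 < c₁ ∧ 0 < α₂ ∧ 1 < c₂ ∧ 1 < lam₁ ∧ 0 < β₁ ∧ 0 < β₂ ∧ 1 < lam₂ ∧
      ∀ {cmin cmax δ : ℝ} {L : ℕ → ℕ} {ε c : ℕ → ℝ}
        {R : ℕ → (EuclideanSpace ℝ (Fin 3) ≃ₗᵢ[ℝ] EuclideanSpace ℝ (Fin 3))}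
        {u : ℕ → ℝ → EuclideanSpace ℝ (Fin 3) → EuclideanSpace ℝ (Fin 3)}
        {p : ℕ → ℝ → EuclideanSpace ℝ (Fin 3) → ℝ}
        {d : ℕ → ℝ → EuclideanSpace ℝ (Fin 3) → EuclideanSpace ℝ (Fin 3)},
        1 < cmin → 0 < δ → Tendsto ε atTop (𝓝 0) →
        (∀ n, AngularLadder.IsWindowProfile (L n) C₀ cmin cmax δ (ε n) (c n) (R n) (u n) (p n)
          (d n)) →
        ¬ (C₀ ≤ ε₀ ∨
           (∀ n, ∀ t < 0, IsAxisymmetric (u n t)) ∨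
           (∃ q : ℕ, 0 < q ∧ cmax ^ q < κ ∧
              ∀ x, Tendsto (fun n => ((R n) ^ q) x) atTop (𝓝 x)) ∨
           (∃ (q : ℕ) (g : ℕ → (EuclideanSpace ℝ (Fin 3) ≃ₗᵢ[ℝ] EuclideanSpace ℝ (Fin 3)))
              (θ : ℕ → ℝ),
              0 < q ∧ cmax ^ q < c₁ ∧ (∀ n x, ((R n) ^ q) x = g n (rotZ (θ n) ((g n).symm x))) ∧
              ∀ n, |θ n| ≤ 2 * α₁ * (q * Real.log (c n))) ∨
           (∃ (Θ ℓ : ℝ) (g : ℕ → (EuclideanSpace ℝ (Fin 3) ≃ₗᵢ[ℝ] EuclideanSpace ℝ (Fin 3)))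
              (θ : ℕ → ℝ),
              ℓ < Real.log c₂ ∧ (∀ n x, R n x = g n (rotZ (θ n) ((g n).symm x))) ∧
              (∀ n, |θ n| ≤ Θ) ∧ (∀ n, 2 * α₂ * Real.log (c n) ≤ |θ n|) ∧
              ∀ n, (1 + (θ n / (2 * Real.log (c n))) ^ 2) * Real.log (c n) ≤ ℓ) ∨
           (∃ lam : ℝ, 1 < lam ∧ lam < lam₁ ∧ ∀ n, IsDiscretelySelfSimilar lam (u n)) ∨
           (∀ n, IsSelfSimilar (u n)) ∨
           (∃ (g : ℕ → (EuclideanSpace ℝ (Fin 3) ≃ₗᵢ[ℝ] EuclideanSpace ℝ (Fin 3))) (α : ℕ → ℝ),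
              (∀ n (μ : ℝ), 1 < μ → IsRotatedDSS μ
                (((g n).symm.trans (rotZLIE (2 * α n * Real.log μ))).trans (g n)) (u n)) ∧
              ∀ n, |α n| ≤ β₁ ∨ β₂ ≤ |α n|) ∨
           (∃ M : ℝ≥0∞, M < ⊤ ∧ ∀ n, eLpNorm (u n (-1)) 3 volume ≤ M) ∨
           (∃ M : ℝ≥0∞, M < ⊤ ∧ ∀ n, eLpNorm (u n (-1)) 2 volume ≤ M) ∨
           (∀ η : ℝ, 0 < η → ∃ ρ : ℝ, ∀ n x, ρ ≤ ‖x‖ → ‖x‖ * ‖u n (-1) x‖ ≤ η) ∨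
           (∀ n, ∀ t < 0, ∃ e : EuclideanSpace ℝ (Fin 3), ∀ x,
              curl (u n t) x = ‖curl (u n t) x‖ • e) ∨
           (∀ n, ∃ (d₀ : ℝ) (η : ℝ → ℝ), Tendsto η (𝓝[>] 0) (𝓝 0) ∧
              ∀ s ∈ Ioo (-1 : ℝ) 0, ∀ x y, d₀ < ‖curl (u n s) x‖ → d₀ < ‖curl (u n s) y‖ →
                ‖vorticityDirection (curl (u n s)) x - vorticityDirection (curl (u n s)) y‖ ≤
                  η ‖x - y‖) ∨
           (∃ (n : ℕ) (S : EuclideanSpace ℝ (Fin 3) ≃ₗᵢ[ℝ] EuclideanSpace ℝ (Fin 3))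
              (b : EuclideanSpace ℝ (Fin 3)), S b = b ∧ b ≠ 0 ∧
              ∀ x, ‖u n (-1) (S x + b)‖ = ‖u n (-1) x‖) ∨
           (∃ (n : ℕ) (ρ B : ℝ), 0 < ρ ∧
              ∀ z ∈ parabolicCylinder ρ (0 : ℝ × EuclideanSpace ℝ (Fin 3)), ‖u n z.1 z.2‖ ≤ B) ∨
           (∃ (n : ℕ) (U : EuclideanSpace ℝ (Fin 3) → EuclideanSpace ℝ (Fin 3)),
              Continuous U ∧ ∀ t < 0, u n t = U) ∨
           (∃ (n : ℕ) (e : EuclideanSpace ℝ (Fin 3)), ∀ x, ∃ a : ℝ,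
              curl (u n (-1)) x = a • e) ∨
           (∃ (n : ℕ) (d₀ : ℝ) (η : ℝ → ℝ), Tendsto η (𝓝[>] 0) (𝓝 0) ∧
              ∀ s ∈ Ioo (-1 : ℝ) 0, ∀ x y, d₀ < ‖curl (u n s) x‖ → d₀ < ‖curl (u n s) y‖ →
                min ‖vorticityDirection (curl (u n s)) x - vorticityDirection (curl (u n s)) y‖
                    ‖vorticityDirection (curl (u n s)) x + vorticityDirection (curl (u n s)) y‖ ≤
                  η ‖x - y‖) ∨
           (∃ (n : ℕ) (ρ M : ℝ), 0 < ρ ∧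
              ∀ z ∈ parabolicCylinder ρ (0 : ℝ × EuclideanSpace ℝ (Fin 3)),
                ‖curl (u n z.1) z.2‖ ≤ M) ∨
           (∃ (n : ℕ) (e : EuclideanSpace ℝ (Fin 3)) (ρ M : ℝ), (R n e = e ∨ R n e = -e) ∧
              0 < ρ ∧ ∀ z ∈ parabolicCylinder ρ (0 : ℝ × EuclideanSpace ℝ (Fin 3)),
                ∃ a : ℝ, ‖u n z.1 z.2 - a • e‖ ≤ M) ∨
           (∃ (n : ℕ) (e : EuclideanSpace ℝ (Fin 3)) (ρ M : ℝ), (R n e = e ∨ R n e = -e) ∧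
              0 < ρ ∧ ∀ z ∈ parabolicCylinder ρ (0 : ℝ × EuclideanSpace ℝ (Fin 3)),
                ∃ a : ℝ, ‖curl (u n z.1) z.2 - a • e‖ ≤ M) ∨
           (∃ (n : ℕ) (S : EuclideanSpace ℝ (Fin 3) ≃ₗᵢ[ℝ] EuclideanSpace ℝ (Fin 3))
              (b : EuclideanSpace ℝ (Fin 3)), S b = b ∧ b ≠ 0 ∧
              ∀ x, ‖u n (-1) x‖ ≤ ‖u n (-1) (S x + b)‖) ∨
           (∃ A : ℕ → (EuclideanSpace ℝ (Fin 3) ≃ₗᵢ[ℝ] EuclideanSpace ℝ (Fin 3)),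
              ∀ θ, ∀ t < 0, ∀ x,
                Tendsto (fun n => (A n).symm (u n t (A n (rotZ θ x))) -
                  rotZ θ ((A n).symm (u n t (A n x)))) atTop (𝓝 0)) ∨
           (∃ (S : EuclideanSpace ℝ (Fin 3) ≃ₗᵢ[ℝ] EuclideanSpace ℝ (Fin 3))
              (b : EuclideanSpace ℝ (Fin 3)), S b = b ∧ b ≠ 0 ∧
              ∀ x, Tendsto (fun n => ‖u n (-1) (S x + b)‖ - ‖u n (-1) x‖) atTop (𝓝 0)) ∨
           (∀ s < 0, ∀ t < 0, ∀ x, Tendsto (fun n => u n t x - u n s x) atTop (𝓝 0)) ∨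
           (∃ (A : ℕ → (EuclideanSpace ℝ (Fin 3) ≃ₗᵢ[ℝ] EuclideanSpace ℝ (Fin 3))) (α : ℕ → ℝ),
              Tendsto α atTop (𝓝 0) ∧ (∀ n, α n ≠ 0) ∧ ∀ n, ∀ t < 0, ∀ x,
                (A n).symm (u n t (A n (rotZ (α n) x))) =
                  rotZ (α n) ((A n).symm (u n t (A n x)))) ∨
           (∃ σ : ℕ → ℝ, (∀ n, 1 < σ n) ∧ Tendsto σ atTop (𝓝 1) ∧
              ∀ n, IsDiscretelySelfSimilar (σ n) (u n)) ∨
           (∃ lam : ℝ, 1 < lam ∧ lam < lam₂ ∧ ∀ t < 0, ∀ x,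
              Tendsto (fun n => lam • u n (lam ^ 2 * t) (lam • x) - u n t x) atTop (𝓝 0)) ∨
           (∃ (n : ℕ) (τ : ℝ), 0 < τ ∧ ∀ t < 0, ∀ x, u n (t - τ) x = u n t x) ∨
           (∃ (τ : ℕ → ℝ) (τ₀ : ℝ), 0 < τ₀ ∧ Tendsto τ atTop (𝓝 τ₀) ∧
              ∀ t < 0, ∀ x, Tendsto (fun n => u n (t - τ n) x - u n t x) atTop (𝓝 0)) ∨
           (∃ (n : ℕ) (U : EuclideanSpace ℝ (Fin 3) → EuclideanSpace ℝ (Fin 3))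
              (b : EuclideanSpace ℝ (Fin 3)), ∀ t < 0, ∀ x, u n t x = U (x - t • b)) ∨
           (∃ b : EuclideanSpace ℝ (Fin 3), ∀ s < 0, ∀ t < 0, ∀ x,
              Tendsto (fun n => u n t (x + t • b) - u n s (x + s • b)) atTop (𝓝 0)) ∨
           (∃ n : ℕ, ∀ lam : ℝ, 0 < lam → lam < 1 → ∀ x,
              lam • u n (-1) (lam • x) = u n (-1) x) ∨
           (∀ lam : ℝ, 0 < lam → lam < 1 → ∀ x,
              Tendsto (fun n => lam • u n (-1) (lam • x) - u n (-1) x) atTop (𝓝 0)) ∨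
           (∃ (n : ℕ) (g : ℝ → (EuclideanSpace ℝ (Fin 3) ≃ₗᵢ[ℝ] EuclideanSpace ℝ (Fin 3))),
              ∀ s < 0, ∀ t < 0, ∀ x, ‖u n s (g s x)‖ = ‖u n t (g t x)‖) ∨
           (∃ g : ℝ → (EuclideanSpace ℝ (Fin 3) ≃ₗᵢ[ℝ] EuclideanSpace ℝ (Fin 3)),
              ∀ s < 0, ∀ t < 0, ∀ x,
                Tendsto (fun n => ‖u n s (g s x)‖ - ‖u n t (g t x)‖) atTop (𝓝 0)) ∨
           (∃ (n : ℕ) (lam : ℝ), 0 < lam ∧ lam < 1 ∧ ∀ x,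
              lam • u n (-1) (lam • x) = u n (-1) x) ∨
           (∃ lam : ℝ, 0 < lam ∧ lam < 1 ∧ ∀ x,
              Tendsto (fun n => lam • u n (-1) (lam • x) - u n (-1) x) atTop (𝓝 0)) ∨
           (∃ (n : ℕ) (lam μ : ℝ), 0 < lam ∧ lam < 1 ∧ ∀ x,
              μ • u n (-1) (lam • x) = u n (-1) x) ∨
           (∃ lam μ : ℝ, 0 < lam ∧ lam < 1 ∧ ∀ x,
              Tendsto (fun n => μ • u n (-1) (lam • x) - u n (-1) x) atTop (𝓝 0)) ∨
           (∃ σ : EuclideanSpace ℝ (Fin 3) ≃ₗᵢ[ℝ] EuclideanSpace ℝ (Fin 3),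
              ∀ t < 0, ∀ x, Tendsto (fun n => σ (u n t (σ.symm x)) + u n t x) atTop (𝓝 0)) ∨
           (∀ t < 0, ∀ x, Tendsto (fun n => u n t x - u n t (-x)) atTop (𝓝 0)) ∨
           (∀ t < 0, ∀ φ : EuclideanSpace ℝ (Fin 3) → EuclideanSpace ℝ (Fin 3),
              ContDiff ℝ ∞ φ → HasCompactSupport φ → VectorCalculus.IsDivFree φ →
                Tendsto (fun n => ∫ x, ⟪convect (u n t) (u n t) x, φ x⟫) atTop (𝓝 0)) ∨
           (∃ n : ℕ, ∀ t < 0, ∃ q : EuclideanSpace ℝ (Fin 3) → ℝ, ContDiff ℝ ∞ q ∧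
              AngularLadder.IsCobandLimited (L n) fun x =>
                convect (u n t) (u n t) x + gradient q x) ∨
           (∀ t < 0, ∀ x, Tendsto (fun n => ‖x‖ ^ 2 • u n t x - ⟪u n t x, x⟫ • x) atTop (𝓝 0)) ∨
           (∃ e : EuclideanSpace ℝ (Fin 3), e ≠ 0 ∧ ∀ t < 0, ∀ x,
              Tendsto (fun n => ‖e‖ ^ 2 • u n t x - ⟪u n t x, e⟫ • e) atTop (𝓝 0))) := by
  obtain ⟨ε₀, hε₀, H⟩ := excludedStrata_windowSequences_v18
  refine ⟨ε₀, hε₀, fun C₀ => ?_⟩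
  obtain ⟨κ, α₁, c₁, α₂, c₂, lam₁, β₁, β₂, lam₂, hκ, hα₁, hc₁, hα₂, hc₂, hlam₁, hβ₁, hβ₂, hlam₂,
    HC⟩ := H C₀
  refine ⟨κ, α₁, c₁, α₂, c₂, lam₁, β₁, β₂, lam₂, hκ, hα₁, hc₁, hα₂, hc₂, hlam₁, hβ₁, hβ₂, hlam₂,
    fun {cmin cmax δ L ε c R u p d} hcmin hδ hε hW => ?_⟩
  have HC' := HC hcmin hδ hε hW
  simp only [not_or] at HC' ⊢
  obtain ⟨h0, h1, h2, h3, h4, h5, h6, h7, h8, h9, h10, h11, h12, h13, h14, h15, h16, h17, h18, h19,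
    h20, h21, h22, h23, h24, h25, h26, h27, h28, h29, h30, h31, h32, h33, h34, h35, h36, h37, h38,
    h39, h40, h41, h42, h43⟩ := HC'
  exact ⟨h0, h1, h2, h3, h4, h5, h6, h7, h8, h9, h10, h11, h12, h13, h14, h15, h16, h17, h18, h19,
    h20, h21, h22, h23, h24, h25, h26, h27, h28, h29, h30, h31, h32, h33, h34, h35, h36, h37, h38,
    h39, h40, h41, h42, h43, no_windowSequence_asymptoticallyRadial_census hcmin hδ hε hW,
    no_windowSequence_asymptoticallyUnidirectional_census hcmin hδ hε hW⟩

end Summit.NavierStokesRegularity.AngularGalerkinLadderExcludedStrataCensusV19
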